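import Summits.Ventures.YMGap.RobustBall.LocalSourceScreeningMetric
import HarnessLib

/-!
# Venture YMGap, track ROBUST-BALL (Y2) — screening with a BACKGROUND: the response to a modification of the action
# splits into a global `O(η)` part and an exponentially localised part

HONEST FRAMING. WHAT THIS IS: a venture file (cell `pub-ymgap`, track Y2 ROBUST-BALL, seat rb-p1, theorems only)
unifying ds-1's STATE-STABILITY (global: a modification with one-link oscillation loads `≤ η` EVERYWHERE moves local
expectations by `O(η)`) with rb-p1's SCREENING (`LocalSourceScreening.lean`: a modification localised on `S` is
invisible at distance `D` up to `O(e^{−κ D/max(1,R)})`):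
* `abs_integral_sub_integral_le_of_source_superSolution` — the screening estimate for an ARBITRARY super-solution `d`
  of `(√N/2) min(bV x, 4) + Σ_{y ∈ nbr x} C x y d y ≤ d x` (Föllmer (2.8)/(2.10) verbatim): `|∫ f dμ − ∫ f dν| ≤ Σ_{y∈Δ} d y δ_y`;
* `superSolution_geometric_add_const` — bookkeeping: a defect `≤ η'` where a profile `ℓ` is nonzero and `≤ η' + B'`
  everywhere has the super-solution `η'/(1−c) + B'/(1−c) · c^{ℓ}`;
* ★ `abs_integral_sub_integral_le_of_source_background` — member `(W, supp)` (rows `≤ ρ < 1`), source `V` of ANY strength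
  whose one-link oscillation loads are `≤ η` OFF the region where the profile vanishes (a small GLOBAL background) and
  `≤ B` everywhere: for every DLR `μ` of `W`, EVERY DLR `ν` of `W + V`, every local Lipschitz `f` on `Δ`:
  `|∫ f dμ − ∫ f dν| ≤ Σ_{y ∈ Δ} ((√N/2) min(η,4) + (√N/2) min(B,4) ρ^{ℓ y})/(1 − ρ) · δ_y`;
  metric/cylinder reading `abs_integral_sub_integral_le_of_source_background_cylinder`: for a source `≤ η` off the finite
  link set `S` and `≤ B` on it, `|∫ F dμ − ∫ F dν| ≤ ((√N/2) min(η,4) + (√N/2) min(B,4) e^{κ} e^{−(κ/max(1,R)) d(Λ,S)})/(1 − max(ρ,½)) · #Λ · K_F`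
  — at `B = η` (or `S = ∅`) this is the global state-stability bound, at `η = 0` the screening bound.
WHAT THIS IS NOT: one-sided Dobrushin-comparison bounds; lattice strong coupling only, nothing about the continuum
limit or a Clay-sense mass gap.
-/

noncomputable section

open MeasureTheory Function Finset ProbabilityTheory Real
open scoped NNReal
open Literature.Probability.LatticeModels
open Literature.Probability.LatticeModels.DobrushinMetric
open Literature.MathematicalPhysics.QuantumLattice
open Literature.MathematicalPhysics.QuantumFieldTheory hiding ZdEdge

namespace Summit.Ventures.YMGap.RobustBall

variable {d N : ℕ}

/-! ### The screening estimate for an arbitrary super-solution -/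

/-- **Screening with an arbitrary super-solution** (Föllmer (2.8)/(2.10)).  Member `(W, supp)` contracting with
coefficients `C` over `perturbedNbr supp` (rows `≤ ρ < 1`); source `(V, suppV)` with one-link oscillation loads `≤ bV`;
any `d ≥ 0` with `(√N/2) min(bV x, 4) + Σ_{y ∈ perturbedNbr supp x} C x y d y ≤ d x` for all links `x`.  Then every DLR
`μ` of `W` and every DLR `ν` of `W + V` satisfy `|∫ f dμ − ∫ f dν| ≤ Σ_{y ∈ Δ} d y δ_y`. -/
theorem abs_integral_sub_integral_le_of_source_superSolution (hd : 1 ≤ d) {β ρ : ℝ}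
    {W : Potential (ZdEdge d) (Matrix.specialUnitaryGroup (Fin N) ℂ)} (hW : W.IsAdapted)
    (hWb : ∀ X, ∃ C, ∀ U, |W X U| ≤ C)
    {supp : Finset (ZdEdge d) → Finset (Finset (ZdEdge d))} (hsupp : W.IsSupportedBy supp)
    {C : ZdEdge d → ZdEdge d → ℝ}
    (hKR : IsKRContraction (perturbedYM (d := d) (fundamentalRep (Fin N)) (N * β) W supp) suFrobDist
      (perturbedNbr supp) C)
    (hrow : ∀ x, ∑ y ∈ perturbedNbr supp x, C x y ≤ ρ) (hρ : ρ < 1)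
    {V : Potential (ZdEdge d) (Matrix.specialUnitaryGroup (Fin N) ℂ)} (hV : V.IsAdapted)
    (hVb : ∀ X, ∃ C, ∀ U, |V X U| ≤ C)
    {suppV : Finset (ZdEdge d) → Finset (Finset (ZdEdge d))} (hsuppV : V.IsSupportedBy suppV)
    {oscV : Finset (ZdEdge d) → ZdEdge d → ℝ} (hoscV : ∀ X, Dobrushin.IsOscBound (V X) (oscV X))
    {bV : ZdEdge d → ℝ} (hbV : ∀ e, ∑ X ∈ (suppV {e}).filter (fun X => e ∈ X), oscV X e ≤ bV e)
    {dd : ZdEdge d → ℝ} (hdd0 : ∀ y, 0 ≤ dd y)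
    (hsuper : ∀ x, Real.sqrt N / 2 * min (bV x) 4 + ∑ y ∈ perturbedNbr supp x, C x y * dd y ≤ dd x)
    {μ ν : Measure (LGConfig d (Matrix.specialUnitaryGroup (Fin N) ℂ))}
    (hμ : μ ∈ perturbedGibbsMeasures (d := d) (fundamentalRep (Fin N)) (N * β) W supp)
    (hν : ν ∈ perturbedGibbsMeasures (d := d) (fundamentalRep (Fin N)) (N * β) (W + V)
      (fun Λ => supp Λ ∪ suppV Λ))
    {f : LGConfig d (Matrix.specialUnitaryGroup (Fin N) ℂ) → ℝ} (hfm : Measurable f)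
    {Δ : Finset (ZdEdge d)} (hfdep : DependsOn f (↑Δ : Set (ZdEdge d))) {M : ℝ} (hM : ∀ σ, |f σ| ≤ M)
    {δ : ZdEdge d → ℝ} (hδ : IsLipBound suFrobDist f δ) :
    |(∫ σ, f σ ∂μ) - ∫ σ, f σ ∂ν| ≤ ∑ y ∈ Δ, dd y * δ y := by
  classical
  haveI : SecondCountableTopology (Matrix (Fin N) (Fin N) ℂ) :=
    inferInstanceAs (SecondCountableTopology (Fin N → Fin N → ℂ))
  haveI : SecondCountableTopology (Matrix.specialUnitaryGroup (Fin N) ℂ) :=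
    Topology.IsEmbedding.subtypeVal.secondCountableTopology
  have hWV : (W + V).IsAdapted := isAdapted_add hW hV
  have hWVb : ∀ X, ∃ C, ∀ U, |(W + V) X U| ≤ C := fun X => by
    obtain ⟨C₁, h₁⟩ := hWb X; obtain ⟨C₂, h₂⟩ := hVb X
    exact ⟨C₁ + C₂, fun U => (abs_add_le _ _).trans (add_le_add (h₁ U) (h₂ U))⟩
  have hsuppWV : (W + V).IsSupportedBy (fun Λ => supp Λ ∪ suppV Λ) := isSupportedBy_add_union hsupp hsuppV
  have hC0 : ∀ x y, 0 ≤ C x y := hKR.nonneg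
  have hρ0 : 0 ≤ ρ := by
    have hd0 : 0 < d := hd
    let e₀ : ZdEdge d := (0, ⟨0, hd0⟩)
    exact (Finset.sum_nonneg fun y _ => hC0 e₀ y).trans (hrow e₀)
  have hbV0 : ∀ e, 0 ≤ bV e := fun e =>
    (Finset.sum_nonneg fun X _ => (hoscV X).nonneg e).trans (hbV e)
  have hγ : IsSpecification (perturbedYM (d := d) (fundamentalRep (Fin N)) (N * β) W supp) :=
    isSpecification_perturbedYM _ (continuous_fundamentalRep (Fin N)) _ hW hWb hsupp
  have hγ' : IsSpecification (perturbedYM (d := d) (fundamentalRep (Fin N)) (N * β) (W + V)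
      (fun Λ => supp Λ ∪ suppV Λ)) :=
    isSpecification_perturbedYM _ (continuous_fundamentalRep (Fin N)) _ hWV hWVb hsuppWV
  have hμ' : IsGibbsMeasure (perturbedYM (d := d) (fundamentalRep (Fin N)) (N * β) W supp) μ := hμ
  have hν' : IsGibbsMeasure (perturbedYM (d := d) (fundamentalRep (Fin N)) (N * β) (W + V)
      (fun Λ => supp Λ ∪ suppV Λ)) ν := hν
  have hR₀ : (0 : ℝ) ≤ 2 * Real.sqrt N := by positivity
  set b : ZdEdge d → ℝ := fun x => Real.sqrt N / 2 * min (bV x) 4 with hb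
  have hb0 : ∀ x, 0 ≤ b x := fun x => by
    simp only [hb]; exact mul_nonneg (by positivity) (le_min (hbV0 x) (by norm_num))
  have hker : ∀ (x : ZdEdge d) (η : LGConfig d (Matrix.specialUnitaryGroup (Fin N) ℂ))
      (φ : Matrix.specialUnitaryGroup (Fin N) ℂ → ℝ) (L : ℝ), Measurable φ → (∃ M, ∀ s, |φ s| ≤ M) →
      0 ≤ L → (∀ a a', |φ a - φ a'| ≤ L * suFrobDist a a') →
      |(∫ s, φ s ∂(siteLaw (perturbedYM (fundamentalRep (Fin N)) (N * β) W supp) x η)) -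
          ∫ s, φ s ∂(siteLaw (perturbedYM (fundamentalRep (Fin N)) (N * β) (W + V)
            (fun Λ => supp Λ ∪ suppV Λ)) x η)| ≤ b x * L :=
    fun x η φ L hφm hφb hL hφL => by
      simpa only [hb] using oneLink_source_defect β hW hWb hV hVb hsupp hsuppV hoscV x (hbV x) η φ L hφm hφb hL hφL
  exact abs_integral_sub_integral_le_of_gibbs_pair_local hγ hγ' hKR (fun _ _ => suFrobDist_nonneg _ _)
    suFrobDist_le hR₀ hρ0 hρ hrow hμ' hν' hb0 hker hdd0 hsuper hfm hfdep hM hδ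

/-! ### A background plus a localised defect: the super-solution -/

section SuperSolution

variable {V : Type*}

/-- **Super-solution for a background plus a localised defect** (linearity of Föllmer's (2.10)): if `b ≤ η' + B'`
everywhere, `b x ≤ η'` wherever `ℓ x ≠ 0`, the rows of `C ≥ 0` over `nbr x` are `≤ c < 1`, `0 ≤ η'`, `0 ≤ B'`, and
`ℓ x ≤ ℓ y + 1` for `y ∈ nbr x`, then `d x = η'/(1 − c) + B'/(1 − c) · c^{ℓ x}` satisfies `b x + Σ_{y ∈ nbr x} C x y d y ≤ d x`. -/
theorem superSolution_geometric_add_const {nbr : V → Finset V} {C : V → V → ℝ} (hC0 : ∀ x y, 0 ≤ C x y)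
    {c : ℝ} (hc0 : 0 ≤ c) (hc1 : c < 1) (hrow : ∀ x, ∑ y ∈ nbr x, C x y ≤ c)
    {b : V → ℝ} {η' B' : ℝ} (hη' : 0 ≤ η') (hB' : 0 ≤ B') (hbB : ∀ x, b x ≤ η' + B')
    (ℓ : V → ℕ) (hbℓ : ∀ x, ℓ x ≠ 0 → b x ≤ η') (hℓ : ∀ x, ∀ y ∈ nbr x, ℓ x ≤ ℓ y + 1) (x : V) :
    b x + (∑ y ∈ nbr x, C x y * (η' / (1 - c) + B' / (1 - c) * c ^ ℓ y)) ≤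
      η' / (1 - c) + B' / (1 - c) * c ^ ℓ x := by
  have h1c : 0 < 1 - c := sub_pos.2 hc1
  -- the localised part `max 0 (b − η')`
  set bl : V → ℝ := fun x => max 0 (b x - η') with hbl
  have hbl0 : ∀ x, 0 ≤ bl x := fun x => le_max_left _ _
  have hblB : ∀ x, bl x ≤ B' := fun x => max_le hB' (by linarith [hbB x])
  have hblℓ : ∀ x, ℓ x ≠ 0 → bl x = 0 := fun x hx =>
    le_antisymm (max_le le_rfl (by linarith [hbℓ x hx])) (hbl0 x)
  have hgeo := superSolution_geometric hC0 hc0 hc1 hrow hbl0 hblB ℓ hblℓ hℓ x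
  -- the constant part
  have hconst : η' + ∑ y ∈ nbr x, C x y * (η' / (1 - c)) ≤ η' / (1 - c) := by
    rw [← Finset.sum_mul]
    have h1 : (∑ y ∈ nbr x, C x y) * (η' / (1 - c)) ≤ c * (η' / (1 - c)) :=
      mul_le_mul_of_nonneg_right (hrow x) (div_nonneg hη' h1c.le)
    have h2 : η' + c * (η' / (1 - c)) = η' / (1 - c) := by field_simp; ring
    linarith
  have hsplit : ∑ y ∈ nbr x, C x y * (η' / (1 - c) + B' / (1 - c) * c ^ ℓ y) =
      (∑ y ∈ nbr x, C x y * (η' / (1 - c))) + ∑ y ∈ nbr x, C x y * (B' / (1 - c) * c ^ ℓ y) := by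
    rw [← Finset.sum_add_distrib]
    exact Finset.sum_congr rfl fun y _ => by ring
  have hbx : b x ≤ η' + bl x := by
    simp only [hbl]
    rcases le_total (b x - η') 0 with h | h
    · rw [max_eq_left h]; linarith
    · rw [max_eq_right h]; linarith
  rw [hsplit]
  linarith

end SuperSolution

/-! ### Screening with a background -/

/-- **SCREENING WITH A BACKGROUND — profile form.**  Member `(W, supp)` contracting over `perturbedNbr supp` (rows
`≤ ρ < 1`); source `(V, suppV)` of ANY strength whose one-link oscillation loads are `≤ B` everywhere and `≤ η`
wherever the profile `ℓ` (growing by `≤ 1` along `perturbedNbr supp`) is nonzero.  Then every DLR `μ` of `W` and EVERY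
DLR `ν` of `W + V` satisfy, for every local Lipschitz `f` on `Δ`:
`|∫ f dμ − ∫ f dν| ≤ Σ_{y ∈ Δ} ((√N/2) min(η,4) + (√N/2) min(B,4) ρ^{ℓ y})/(1 − ρ) · δ_y`. -/
theorem abs_integral_sub_integral_le_of_source_background (hd : 1 ≤ d) {β ρ : ℝ}
    {W : Potential (ZdEdge d) (Matrix.specialUnitaryGroup (Fin N) ℂ)} (hW : W.IsAdapted)
    (hWb : ∀ X, ∃ C, ∀ U, |W X U| ≤ C)
    {supp : Finset (ZdEdge d) → Finset (Finset (ZdEdge d))} (hsupp : W.IsSupportedBy supp)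
    {C : ZdEdge d → ZdEdge d → ℝ}
    (hKR : IsKRContraction (perturbedYM (d := d) (fundamentalRep (Fin N)) (N * β) W supp) suFrobDist
      (perturbedNbr supp) C)
    (hrow : ∀ x, ∑ y ∈ perturbedNbr supp x, C x y ≤ ρ) (hρ : ρ < 1)
    {V : Potential (ZdEdge d) (Matrix.specialUnitaryGroup (Fin N) ℂ)} (hV : V.IsAdapted)
    (hVb : ∀ X, ∃ C, ∀ U, |V X U| ≤ C)
    {suppV : Finset (ZdEdge d) → Finset (Finset (ZdEdge d))} (hsuppV : V.IsSupportedBy suppV)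
    {oscV : Finset (ZdEdge d) → ZdEdge d → ℝ} (hoscV : ∀ X, Dobrushin.IsOscBound (V X) (oscV X))
    {bV : ZdEdge d → ℝ} (hbV : ∀ e, ∑ X ∈ (suppV {e}).filter (fun X => e ∈ X), oscV X e ≤ bV e)
    {η B : ℝ} (hη : 0 ≤ η) (hB : ∀ e, bV e ≤ B)
    (ℓ : ZdEdge d → ℕ) (hℓV : ∀ e, ℓ e ≠ 0 → bV e ≤ η) (hℓ : ∀ x, ∀ y ∈ perturbedNbr supp x, ℓ x ≤ ℓ y + 1)
    {μ ν : Measure (LGConfig d (Matrix.specialUnitaryGroup (Fin N) ℂ))}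
    (hμ : μ ∈ perturbedGibbsMeasures (d := d) (fundamentalRep (Fin N)) (N * β) W supp)
    (hν : ν ∈ perturbedGibbsMeasures (d := d) (fundamentalRep (Fin N)) (N * β) (W + V)
      (fun Λ => supp Λ ∪ suppV Λ))
    {f : LGConfig d (Matrix.specialUnitaryGroup (Fin N) ℂ) → ℝ} (hfm : Measurable f)
    {Δ : Finset (ZdEdge d)} (hfdep : DependsOn f (↑Δ : Set (ZdEdge d))) {M : ℝ} (hM : ∀ σ, |f σ| ≤ M)
    {δ : ZdEdge d → ℝ} (hδ : IsLipBound suFrobDist f δ) :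
    |(∫ σ, f σ ∂μ) - ∫ σ, f σ ∂ν| ≤
      ∑ y ∈ Δ, (Real.sqrt N / 2 * min η 4 + Real.sqrt N / 2 * min B 4 * ρ ^ ℓ y) / (1 - ρ) * δ y := by
  have hC0 : ∀ x y, 0 ≤ C x y := hKR.nonneg
  have hd0 : 0 < d := hd
  have hρ0 : 0 ≤ ρ := (Finset.sum_nonneg fun y _ => hC0 (0, ⟨0, hd0⟩) y).trans (hrow _)
  have hbV0 : ∀ e, 0 ≤ bV e := fun e =>
    (Finset.sum_nonneg fun X _ => (hoscV X).nonneg e).trans (hbV e)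
  have h1ρ : 0 < 1 - ρ := sub_pos.2 hρ
  have hsq : 0 ≤ Real.sqrt N / 2 := by positivity
  -- the defect `(√N/2) min(bV,4)`: `≤ η'` off the region, `≤ η' + B''` everywhere
  set η' : ℝ := Real.sqrt N / 2 * min η 4 with hη'
  set B'' : ℝ := Real.sqrt N / 2 * min B 4 with hB''
  have hη'0 : 0 ≤ η' := mul_nonneg hsq (le_min hη (by norm_num))
  have hB0 : 0 ≤ min B 4 := le_min ((hbV0 (0, ⟨0, hd0⟩)).trans (hB _)) (by norm_num)
  have hB''0 : 0 ≤ B'' := mul_nonneg hsq hB0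
  have hbB : ∀ x, Real.sqrt N / 2 * min (bV x) 4 ≤ η' + B'' := fun x => by
    have : Real.sqrt N / 2 * min (bV x) 4 ≤ B'' := mul_le_mul_of_nonneg_left (min_le_min_right 4 (hB x)) hsq
    linarith
  have hbℓ : ∀ x, ℓ x ≠ 0 → Real.sqrt N / 2 * min (bV x) 4 ≤ η' := fun x hx =>
    mul_le_mul_of_nonneg_left (min_le_min_right 4 (hℓV x hx)) hsq
  have hsuper := superSolution_geometric_add_const (nbr := perturbedNbr supp) hC0 hρ0 hρ hrow hη'0 hB''0 hbB ℓ
    hbℓ hℓ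
  have hdd0 : ∀ y, 0 ≤ η' / (1 - ρ) + B'' / (1 - ρ) * ρ ^ ℓ y := fun y => by positivity
  have key := abs_integral_sub_integral_le_of_source_superSolution hd hW hWb hsupp hKR hrow hρ hV hVb hsuppV hoscV hbV
    hdd0 hsuper hμ hν hfm hfdep hM hδ
  refine key.trans (le_of_eq (Finset.sum_congr rfl fun y _ => ?_))
  simp only [hη', hB'']
  field_simp

/-- **SCREENING WITH A BACKGROUND — Lipschitz-cylinder form.**  Member of range `R`; source `≤ η` off the finite link
set `S`, `≤ B` everywhere; Lipschitz cylinder `F` (`Λ`, `K_F`) at distance `d(Λ,S)`; `κ = −log max(ρ,½)`: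
`|∫ F dμ − ∫ F dν| ≤ ((√N/2) min(η,4) + (√N/2) min(B,4) · e^{κ} · e^{−(κ/max(1,R)) d(Λ,S)})/(1 − max(ρ,½)) · #Λ · K_F`. -/
theorem abs_integral_sub_integral_le_of_source_background_cylinder (hd : 1 ≤ d) {β ρ R : ℝ}
    {W : Potential (ZdEdge d) (Matrix.specialUnitaryGroup (Fin N) ℂ)} (hW : W.IsAdapted)
    (hWb : ∀ X, ∃ C, ∀ U, |W X U| ≤ C)
    {supp : Finset (ZdEdge d) → Finset (Finset (ZdEdge d))} (hsupp : W.IsSupportedBy supp)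
    (hR : ∀ e, ∀ X ∈ supp {e}, e ∈ X → ∀ y ∈ X, ‖e.1 - y.1‖ ≤ R)
    {C : ZdEdge d → ZdEdge d → ℝ}
    (hKR : IsKRContraction (perturbedYM (d := d) (fundamentalRep (Fin N)) (N * β) W supp) suFrobDist
      (perturbedNbr supp) C)
    (hrow : ∀ x, ∑ y ∈ perturbedNbr supp x, C x y ≤ ρ) (hρ : ρ < 1)
    {V : Potential (ZdEdge d) (Matrix.specialUnitaryGroup (Fin N) ℂ)} (hV : V.IsAdapted)
    (hVb : ∀ X, ∃ C, ∀ U, |V X U| ≤ C)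
    {suppV : Finset (ZdEdge d) → Finset (Finset (ZdEdge d))} (hsuppV : V.IsSupportedBy suppV)
    {oscV : Finset (ZdEdge d) → ZdEdge d → ℝ} (hoscV : ∀ X, Dobrushin.IsOscBound (V X) (oscV X))
    {bV : ZdEdge d → ℝ} (hbV : ∀ e, ∑ X ∈ (suppV {e}).filter (fun X => e ∈ X), oscV X e ≤ bV e)
    {η B : ℝ} (hη : 0 ≤ η) (hB : ∀ e, bV e ≤ B) {S : Finset (ZdEdge d)} (hS : ∀ e, e ∉ S → bV e ≤ η)
    {μ ν : Measure (LGConfig d (Matrix.specialUnitaryGroup (Fin N) ℂ))}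
    (hμ : μ ∈ perturbedGibbsMeasures (d := d) (fundamentalRep (Fin N)) (N * β) W supp)
    (hν : ν ∈ perturbedGibbsMeasures (d := d) (fundamentalRep (Fin N)) (N * β) (W + V)
      (fun Λ => supp Λ ∪ suppV Λ))
    {F : LGConfig d (Matrix.specialUnitaryGroup (Fin N) ℂ) → ℝ} {Λ : Finset (ZdEdge d)} {KF : ℝ≥0}
    (hF : IsLipschitzCylinder (fundamentalRep (Fin N)) F Λ KF) :
    |(∫ σ, F σ ∂μ) - ∫ σ, F σ ∂ν| ≤
      (Real.sqrt N / 2 * min η 4 + Real.sqrt N / 2 * min B 4 * (exp (-Real.log (max ρ (1 / 2))) *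
        exp (-(-Real.log (max ρ (1 / 2)) / max 1 R) * setDistEdges Λ S))) / (1 - max ρ (1 / 2)) * (Λ.card * KF) := by
  classical
  set c' : ℝ := max ρ (1 / 2) with hc'
  have hc'0 : 0 < c' := lt_max_of_lt_right (by norm_num)
  have hc'1 : c' < 1 := max_lt hρ (by norm_num)
  have h1c : 0 < 1 - c' := sub_pos.2 hc'1
  have hrow' : ∀ x, ∑ y ∈ perturbedNbr supp x, C x y ≤ c' := fun x => (hrow x).trans (le_max_left _ _)
  have hR₀0 : (0 : ℝ) < max 1 R := zero_lt_one.trans_le (le_max_left _ _)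
  set ℓ : ZdEdge d → ℕ := fun y => ⌊linkSetDist S y / max 1 R⌋₊ with hℓ
  have hℓS : ∀ e, ℓ e ≠ 0 → bV e ≤ η := fun e he => hS e fun heS => he (by
    simp [hℓ, linkSetDist_eq_zero_of_mem heS])
  have hℓ1 : ∀ x, ∀ y ∈ perturbedNbr supp x, ℓ x ≤ ℓ y + 1 := fun x y hy => floor_linkSetDist_le_succ hR S x hy
  have hA : ∀ a b : Matrix.specialUnitaryGroup (Fin N) ℂ,
      dist (suEntries a) (suEntries b) ≤ 1 * suFrobDist a b :=
    fun a b => by rw [one_mul]; exact dist_suEntries_le_suFrobDist a b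
  have key := abs_integral_sub_integral_le_of_source_background hd hW hWb hsupp hKR hrow' hc'1 hV hVb hsuppV hoscV hbV
    hη hB ℓ hℓS hℓ1 hμ hν hF.measurable hF.dependsOn hF.abs_le (hF.isLipBound zero_le_one hA)
  refine key.trans ?_
  -- bookkeeping: `c'^{ℓ y} ≤ e^{κ} e^{−(κ/R₀) d(Λ,S)}` on `Λ`, and `Σ_{y∈Λ} 1·K_F = #Λ K_F`
  set κ : ℝ := -Real.log c' with hκ
  have hκ0 : 0 < κ := neg_pos.2 (Real.log_neg hc'0 hc'1)
  have hd0 : 0 < d := hd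
  have hbV0 : ∀ e, 0 ≤ bV e := fun e =>
    (Finset.sum_nonneg fun X _ => (hoscV X).nonneg e).trans (hbV e)
  have hsq : 0 ≤ Real.sqrt N / 2 := by positivity
  have hB0 : 0 ≤ Real.sqrt N / 2 * min B 4 :=
    mul_nonneg hsq (le_min ((hbV0 (0, ⟨0, hd0⟩)).trans (hB _)) (by norm_num))
  have hη0 : 0 ≤ Real.sqrt N / 2 * min η 4 := mul_nonneg hsq (le_min hη (by norm_num))
  have hgeom : ∀ y ∈ Λ, c' ^ ℓ y ≤ exp κ * exp (-(κ / max 1 R) * setDistEdges Λ S) := by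
    intro y hy
    have hm : ⌊setDistEdges Λ S / max 1 R⌋₊ ≤ ℓ y :=
      Nat.floor_mono (div_le_div_of_nonneg_right (setDistEdges_le_linkSetDist hy) hR₀0.le)
    refine (pow_le_pow_of_le_one hc'0.le hc'1.le hm).trans ?_
    have hfl : setDistEdges Λ S / max 1 R - 1 ≤ (⌊setDistEdges Λ S / max 1 R⌋₊ : ℝ) := by
      have := Nat.lt_floor_add_one (setDistEdges Λ S / max 1 R)
      linarith
    rw [← exp_add, ← Real.rpow_natCast, Real.rpow_def_of_pos hc'0]
    refine exp_le_exp.2 ?_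
    have hlog : Real.log c' = -κ := by rw [hκ, neg_neg]
    rw [hlog]
    have := mul_le_mul_of_nonneg_left hfl hκ0.le
    have e1 : -(κ / max 1 R) * setDistEdges Λ S = -(κ * (setDistEdges Λ S / max 1 R)) := by field_simp
    rw [e1]
    linarith
  calc ∑ y ∈ Λ, (Real.sqrt N / 2 * min η 4 + Real.sqrt N / 2 * min B 4 * c' ^ ℓ y) / (1 - c') *
        (if y ∈ Λ then (1 : ℝ) * (KF : ℝ) else 0)
      ≤ ∑ y ∈ Λ, (Real.sqrt N / 2 * min η 4 + Real.sqrt N / 2 * min B 4 *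
          (exp κ * exp (-(κ / max 1 R) * setDistEdges Λ S))) / (1 - c') * KF :=
        Finset.sum_le_sum fun y hy => by
          rw [if_pos hy, one_mul]
          refine mul_le_mul_of_nonneg_right (div_le_div_of_nonneg_right ?_ h1c.le) KF.2
          exact add_le_add le_rfl (mul_le_mul_of_nonneg_left (hgeom y hy) hB0)
    _ = _ := by rw [Finset.sum_const, nsmul_eq_mul]; ring

end Summit.Ventures.YMGap.RobustBall

end
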